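import Mathlib
import HarnessLib

/-!
# Möbius sums twisted by characters to powerful (`2`-power) moduli (Banks–Shparlinski 2019, Theorem 2.2)

Topic `Literature/NumberTheory/LFunctions` (next to `MoebiusTwoPowerModuli.lean`, Green's Theorem 3 for the range
`q = 2^t ≤ e^{c√log x}`, PROVED in the tree). Named literature fact(s) relocated by the gate from
`Summits/ValiantsHypothesis/ValiantsHypothesis/Theorems/LiouvilleSarnakAlignedTypeICharactersMod2nTwistedLiouvilleOfBS.lean`
(accept-time relocation of `[cite]`d propositions written inline in a Summits proposal; human ruling 2026-08-15).

Source: W. D. Banks, I. E. Shparlinski, *Sums with the Möbius function twisted by characters with powerful moduli*,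
Trans. Amer. Math. Soc. 373 (2019/2020) 249–272, doi:10.1090/tran/7914 = arXiv:1801.10276 (held,
`paper:arxiv-1801.10276`, Theorem 2.2 on p. 4; §9 p. 15 notes the bound is trivial for
`log x < B₁⁻¹ (log q)^{2/3} (log log q)^{4/3}`, so no range of `x` is excluded) [BanksShparlinski2019PowerfulModuli].

* `Literature.NumberTheory.LFunctions.BanksShparlinski2019_theorem22_twoPower` — Theorem 2.2 for `q = 2^γ`,
  Möbius part `E₁` (all three ranges), primitive characters, `γ ≥ γ₀`; NOT proved in the tree (its proof is the
  paper's zero-free region for `L(s, χ)` to powerful moduli, §§4–8, plus the explicit-formula bookkeeping of §9).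
  Consumer: `Summit.…LiouvilleSarnak.AlignedTypeI.CharactersModTwoN.twistedLiouvilleSmall_of_BS`.
-/

namespace Literature.NumberTheory.LFunctions

open ArithmeticFunction Finset Filter
open scoped BigOperators ArithmeticFunction.Moebius

/-- **Banks–Shparlinski 2019, Theorem 2.2 (Möbius sums twisted by characters to a powerful modulus), special case
`q = 2^γ`, Möbius part.**  There are an absolute `γ₀ ∈ ℕ` ("`γ₀` a sufficiently large absolute constant"), an absolute
`c > 0` (the theorem's `c` depends only on the core `∏_{p ∣ q} p`, here `= 2`) and an absolute implied constant `C`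
such that for every `γ ≥ γ₀` (then `q = 2^γ` satisfies the theorem's condition (2.1):
`min_p v_p(q) = max_p v_p(q) = γ ≥ γ₀`), every PRIMITIVE Dirichlet character `χ` modulo `2^γ` and every real `x ≥ 2`:
`|M(x, χ)| = |Σ_{1 ≤ n ≤ x} μ(n) χ(n)| ≤ C x E₁(x, q)`, where with `q = 2^γ`,
`Q₁ = exp((log q)^{7/3} (log log q)^{5/3})`, `Q₂ = exp((log q)^7 (log log q)^{-1})`:
`E₁ = exp(-c log x (log q)^{-2/3} (log log q)^{-4/3}) · log x` if `x ≤ Q₁`,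
`E₁ = exp(-c (log x log q)^{1/2} (log log q)^{-1/2})` if `Q₁ < x ≤ Q₂`, and
`E₁ = exp(-c (log x)^{4/7} (log log x)^{-3/7})` if `x > Q₂`.
-- TODO(general form): Theorem 2.2 for every modulus `q` with `min_{p∣q} v_p(q) ≥ 0.7 max_{p∣q} v_p(q) ≥ γ₀` (constant
-- `c` depending on the core of `q`), and its von Mangoldt part `x^{-1} ψ(x, χ) ≪ E₂`.
[cite: BanksShparlinski2019PowerfulModuli, Theorem 2.2 (§2, arXiv:1801.10276 p. 4) and the remark following it (case q = 2^γ)]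
[file NumberTheory/LFunctions/MoebiusCharacterSumsPowerfulModuli] -/
def BanksShparlinski2019_theorem22_twoPower : Prop :=
  ∃ γ₀ : ℕ, ∃ c : ℝ, 0 < c ∧ ∃ C : ℝ, ∀ γ : ℕ, γ₀ ≤ γ →
    ∀ χ : DirichletCharacter ℂ (2 ^ γ), χ.IsPrimitive → ∀ x : ℝ, 2 ≤ x →
      ‖∑ n ∈ Finset.Ioc 0 ⌊x⌋₊, ((ArithmeticFunction.moebius n : ℤ) : ℂ) * χ (n : ZMod (2 ^ γ))‖ ≤
        C * x *
          (if x ≤ Real.exp (Real.log ((2 : ℝ) ^ γ) ^ (7 / 3 : ℝ) * Real.log (Real.log ((2 : ℝ) ^ γ)) ^ (5 / 3 : ℝ))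
            then Real.exp (-(c * Real.log x * Real.log ((2 : ℝ) ^ γ) ^ (-(2 / 3 : ℝ)) *
                    Real.log (Real.log ((2 : ℝ) ^ γ)) ^ (-(4 / 3 : ℝ)))) * Real.log x
          else if x ≤ Real.exp (Real.log ((2 : ℝ) ^ γ) ^ (7 : ℝ) * (Real.log (Real.log ((2 : ℝ) ^ γ)))⁻¹)
            then Real.exp (-(c * (Real.log x * Real.log ((2 : ℝ) ^ γ)) ^ (1 / 2 : ℝ) *
                    Real.log (Real.log ((2 : ℝ) ^ γ)) ^ (-(1 / 2 : ℝ))))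
          else Real.exp (-(c * Real.log x ^ (4 / 7 : ℝ) * Real.log (Real.log x) ^ (-(3 / 7 : ℝ)))))

end Literature.NumberTheory.LFunctions

/-! ## Appended 2026-08-31 (leafhand-val-liouvillesarnak-1 g4): the von Mangoldt half of the same theorem -/

namespace Literature.NumberTheory.LFunctions

open ArithmeticFunction Finset Filter
open scoped BigOperators

/-- **Banks–Shparlinski 2019, Theorem 2.2, special case `q = 2^γ`, von Mangoldt part** ("For every primitive character
`χ` modulo `q` we have `x⁻¹ M(x, χ) ≪ E₁` and `x⁻¹ ψ(x, χ) ≪ E₂`", with `ψ(x, χ) = Σ_{n ≤ x} Λ(n) χ(n)` (eq. (2.2)) and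
`E₂` = `E₁` with the factor `(log x)^j`, `j = 2`, in the first range).  There are an absolute `γ₀ ∈ ℕ`, an absolute `c > 0`
(the theorem's `c` depends only on the core of `q`, here `2`) and an absolute implied constant `C` such that for every
`γ ≥ γ₀`, every PRIMITIVE Dirichlet character `χ` modulo `2^γ` and every real `x ≥ 2`:
`|ψ(x, χ)| = |Σ_{1 ≤ n ≤ x} Λ(n) χ(n)| ≤ C x E₂(x, q)`, where with `q = 2^γ`,
`Q₁ = exp((log q)^{7/3} (log log q)^{5/3})`, `Q₂ = exp((log q)^7 (log log q)^{-1})`: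
`E₂ = exp(-c log x (log q)^{-2/3} (log log q)^{-4/3}) · (log x)²` if `x ≤ Q₁`,
`E₂ = exp(-c (log x log q)^{1/2} (log log q)^{-1/2})` if `Q₁ < x ≤ Q₂`, and
`E₂ = exp(-c (log x)^{4/7} (log log x)^{-3/7})` if `x > Q₂`.
Twin of `BanksShparlinski2019_theorem22_twoPower` (the Möbius part `E₁`).  Consumer: the prime-sum hypothesis (PCS) of
`Summit.…LiouvilleSarnak.AlignedTypeI.CharactersModTwoN.alignedTypeI_of_primeCharSums` (after partial summation and the
reduction of imprimitive characters mod `2^k` to their primitive inducing characters, loc. cit. remark after Thm 2.2).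
-- TODO(general form): Theorem 2.2 for every modulus `q` with `min_{p∣q} v_p(q) ≥ 0.7 max_{p∣q} v_p(q) ≥ γ₀`.
[cite: BanksShparlinski2019PowerfulModuli, Theorem 2.2 (§2, arXiv:1801.10276 p. 4), the ψ(x,χ) ≪ E₂ clause]
[file NumberTheory/LFunctions/MoebiusCharacterSumsPowerfulModuli] -/
def BanksShparlinski2019_theorem22_twoPower_vonMangoldt : Prop :=
  ∃ γ₀ : ℕ, ∃ c : ℝ, 0 < c ∧ ∃ C : ℝ, ∀ γ : ℕ, γ₀ ≤ γ →
    ∀ χ : DirichletCharacter ℂ (2 ^ γ), χ.IsPrimitive → ∀ x : ℝ, 2 ≤ x →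
      ‖∑ n ∈ Finset.Ioc 0 ⌊x⌋₊, ((ArithmeticFunction.vonMangoldt n : ℝ) : ℂ) * χ (n : ZMod (2 ^ γ))‖ ≤
        C * x *
          (if x ≤ Real.exp (Real.log ((2 : ℝ) ^ γ) ^ (7 / 3 : ℝ) * Real.log (Real.log ((2 : ℝ) ^ γ)) ^ (5 / 3 : ℝ))
            then Real.exp (-(c * Real.log x * Real.log ((2 : ℝ) ^ γ) ^ (-(2 / 3 : ℝ)) *
                    Real.log (Real.log ((2 : ℝ) ^ γ)) ^ (-(4 / 3 : ℝ)))) * Real.log x ^ 2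
          else if x ≤ Real.exp (Real.log ((2 : ℝ) ^ γ) ^ (7 : ℝ) * (Real.log (Real.log ((2 : ℝ) ^ γ)))⁻¹)
            then Real.exp (-(c * (Real.log x * Real.log ((2 : ℝ) ^ γ)) ^ (1 / 2 : ℝ) *
                    Real.log (Real.log ((2 : ℝ) ^ γ)) ^ (-(1 / 2 : ℝ))))
          else Real.exp (-(c * Real.log x ^ (4 / 7 : ℝ) * Real.log (Real.log x) ^ (-(3 / 7 : ℝ)))))

end Literature.NumberTheory.LFunctions

/-! ## Relocated from `Summits/ValiantsHypothesis/ValiantsHypothesis/Theorems/LiouvilleSarnakAlignedTypeICharactersMod2nBilinearSieveZeroFreePowerful.lean` (gate, accept-time relocation of cited facts) — BanksShparlinski2019PowerfulModuli -/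

namespace Literature.NumberTheory.LFunctions

open Filter Topology

/-- **Banks–Shparlinski 2019, Theorem 7.2 (zero-free region for `L(s, χ)` to a powerful modulus), special case
`q = 2^γ`, first clause.**  There are constants `A, B > 0` depending only on the core `∏_{p ∣ q} p` of the modulus
(here `= 2`) and an absolute `γ₀` (the paper's standing condition (2.1) on the modulus, which for `q = 2^γ` reads
`γ ≥ γ₀`) such that for every `γ ≥ γ₀` and every PRIMITIVE Dirichlet character `χ` modulo `q = 2^γ`, with
`ϑ₁ = A / ((log q)^{2/3} (log log q)^{1/3})` and `T = exp(B (log q)^{5/3} (log log q)^{1/3})`, the Dirichlet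
`L`-function `L(s, χ)` does not vanish in the region `{σ > 1 − ϑ₁, |t| ≤ T}`; stated on zeros: every zero `ρ` of
`L(s, χ)` with `|Im ρ| ≤ T` has `Re ρ ≤ 1 − ϑ₁`.
-- TODO(general form): the second clause `σ > 1 − ϑ₂ = 1 − A log q / log(q(|t|+3))` for `|t| > T`, and every modulus
-- `q` with `min_{p∣q} v_p(q) ≥ 0.7 max_{p∣q} v_p(q) ≥ γ₀` (constants depending on the core of `q`).
[cite: BanksShparlinski2019PowerfulModuli, Theorem 7.2 (§7, arXiv:1801.10276 p. 11), first clause, case q = 2^γ]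
[file NumberTheory/LFunctions/MoebiusCharacterSumsPowerfulModuli] -/
def BanksShparlinski2019_theorem72_twoPower : Prop :=
  ∃ γ₀ : ℕ, ∃ A : ℝ, 0 < A ∧ ∃ B : ℝ, 0 < B ∧ ∀ γ : ℕ, γ₀ ≤ γ →
    ∀ χ : DirichletCharacter ℂ (2 ^ γ), χ.IsPrimitive → ∀ ρ : ℂ, χ.LFunction ρ = 0 →
      |ρ.im| ≤ Real.exp (B * Real.log ((2 : ℝ) ^ γ) ^ (5 / 3 : ℝ) *
          Real.log (Real.log ((2 : ℝ) ^ γ)) ^ (1 / 3 : ℝ)) →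
        ρ.re ≤ 1 - A / (Real.log ((2 : ℝ) ^ γ) ^ (2 / 3 : ℝ) * Real.log (Real.log ((2 : ℝ) ^ γ)) ^ (1 / 3 : ℝ))

/-! ### §1 Real-analysis bookkeeping: `(log x)⁴ / x → 0` -/

end Literature.NumberTheory.LFunctions
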